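import Mathlib
import Literature.MathematicalPhysics.QuantumFieldTheory.Balaban1983to89.B4Sect5Exhaustion

/-!
# The Sect. 5 Theorem of B4 in `l²`-OPERATOR form — the operator dictionary of (5.6)–(5.10), kernel-proved

T. Bałaban, *Regularity and decay of lattice Green's functions*, Commun. Math. Phys. **89** (1983) 571–597
[Balaban1983RegularityDecay] (= B4 of the series), Sect. 5 Theorem p. 594 (journal page = PDF page + 570; ×2 render
`run/shared/lean/pub/pub-balaban/b2b-balaban-ref1/pages/1983-cmp89-regularity-decay/…-p024-x2.png`; cell transcript
`b2b-balaban-b04/transcript-B4.md` ll. 329–349).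
Unit b2b-balaban-pv23-g7 (surge node prover #23, gen 7, cell pub-balaban; journal claim B4-SECT5-L2 = KERNEL self-row
under the LEMMAS.md yield clause, lineage pv23; GAPS row C-pv23g7-3).  Single tree import: `…B4Sect5Exhaustion` (this
unit's gen-7 module, [ACCEPTED] p185355), whose header DICTIONARY (D-pv23g7.1) flags two typist's readings that this
file turns into THEOREMS; nothing landed is edited.

VALUE = discharge of the two operator-language readings of the printed theorem.  The paper speaks of *"a symmetric
operator defined on the space L²(Ω)"*, of *"A ≥ γ₀I"*, and of *"C_Λ = A_Λ^{−1}, A_Λ is an operator defined on L²(Λ)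
by A_Λ = ΛAΛ"*; the tree (`…B4` D-b04.5 for finite `Ω`, `…B4Sect5Exhaustion` (α)/(β) for arbitrary `Ω`) reads these as
KERNEL statements — coercivity of the quadratic form on finitely supported vectors (`Hyp56Z`), and the inverse kernel
as the exhaustion limit `limInv Λ A` — and `…B4Sect5Exhaustion`'s HONEST SCOPE records *"No ℓ²(Ω; ℝ^N) bounded-operator
formulation is built … the identification of limInv Λ A with the inverse of the ℓ²(Λ)-operator ΛAΛ (which exists by
A_Λ ≥ γ₀I and Lax–Milgram) … is NOT typed here"*.  It is typed and proved here.  NOT summit progress; no new analytic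
input (Schur's test, Lax–Milgram, uniqueness of bounded inverse kernels).

## What is printed (verbatim)

p. 594 [PDF 24]: *"Theorem. Let Ω ⊂ Z^d and let A be a symmetric operator defined on the space L²(Ω) of functions
φ : Ω → R^N and satisfying the following condition: there exist positive constants γ₀, c₀, δ₀ such that
A ≥ γ₀I, |A(x, x′)| ≤ c₀e^{−δ₀|x−x′|}, x, x′ ∈ Ω. (5.6)
Then there exist positive constants c₁, δ₁ such that for arbitrary Λ ⊂ Ω and for C_Λ = A_Λ^{−1}, A_Λ is an operator
defined on L²(Λ) by A_Λ = ΛAΛ. We have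
|C_Λ(x, x′)| ≤ c₁e^{−δ₁|x−x′|}, x, x′ ∈ Λ, (5.7)
|δC_Λ(x, x′)| ≤ c₁e^{−δ₁(|x−x′| + dist(x, Λ^c) + dist(x′, Λ^c))}, δC_Λ = C_Λ − C_Ω. (5.8)
If we perturb the operator A by an operator B such that the condition (5.6) is satisfied for A + B, and additionally
B has the property
|B(x, x′)| ≤ c₀e^{−δ₀(|x−x′| + dist(x, Ω^c) + dist(x′, Ω^c))}, x, x′ ∈ Ω, (5.9)
then we have also
|A_Λ^{−1}(x, x′) − (A + B)_Λ^{−1}(x, x′)| ≤ c₁e^{−δ₁(|x−x′| + dist(x, Ω^c) + dist(x′, Ω^c))}, x, x′ ∈ Λ. (5.10)"*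

## Dictionary (this file's reading of the operator words; everything else as in `…B4Sect5Exhaustion` (γ)/(δ))

(L1) `L²(Ω)` of functions `φ : Ω → ℝ^N` ↦ the real Hilbert space `l²(idx N Ω)`, Mathlib's `lp (fun _ => ℝ) 2` over the
index type `idx N Ω = {p : ℤ^d × Fin N // p.1 ∈ Ω}` (`H`, `KSet`, `idx`); real scalars, as printed (`R^N`).
(L2) "operator A on L²(Ω) with kernel A(x,x′)", `|A(x,x′)| ≤ c₀e^{−δ₀|x−x′|}` ↦ the kernel operator `opA Ω A`
(`(A f)(x) = Σ_{x′∈Ω} A(x,x′)f(x′)`, `opA_apply`), which IS a bounded operator by Schur's test (`kernelOp`,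
`schurBound_kerA`, `‖A_Ω‖ ≤ c₀·N·K_d(δ₀)`, `norm_opA_le`); "symmetric" ↦ `A(x,x′) = A(x′,x)` on `Ω`, which gives
`⟪A_Ω f, g⟫ = ⟪f, A_Ω g⟫` (`opA_symmetric`); "A ≥ γ₀I" ↦ `γ₀‖f‖² ≤ ⟪f, A f⟫` for EVERY `f ∈ l²(Ω)`, the form written as
the double series `Σ_x f(x) Σ_{x′} A(x,x′) f(x′)` (`Hyp56L2.coercive`; `= ⟪A_Ω f, f⟫`, `inner_opA_eq`).
(L3) "A_Λ = ΛAΛ on L²(Λ)" ↦ `opA Λ A` on `l²(idx N Λ)` (same ambient kernel, indices over `Λ`); "C_Λ = A_Λ^{−1}" ↦ the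
inverse of the continuous linear equivalence `opAEquiv` determined by `A_Λ` (Lax–Milgram), and "C_Λ(x,x′)" ↦ its kernel
`G … x x′ = ((A_Λ)⁻¹ δ_{x′})(x)` (`G`, `Ginv`), of which `(A_Λ)⁻¹` IS the integral operator (`inv_apply_eq_tsum`).

## What is kernel-checked here (0 sorry; axioms propext / Classical.choice / Quot.sound only)

§1 `l²` basics [folklore]: `H`, `sq_summable`, `norm_sq_eq_tsum`, `abs_apply_le_norm`, `sum_sq_le_norm_sq`,
`inner_eq_tsum`, `summable_mul_apply`, finitely supported vectors `fs` (+ `fs_apply`, `sum_single_eq_fs`, `tendsto_fs`,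
`norm_fs_sq`, `tsum_mul_fs`).  §2 Schur's test [folklore]: `SchurBound` (+ `summable_row`, `tsum_row_le`, `transpose`,
`summable_row_mul`, `summable_row_abs_mul_sq`), `act`, `act_sq_le`, `sum_act_sq_le`, `memℓp_act`, `actLp` (+ lemmas),
**`kernelOp`** (`kernelOp_apply`, `norm_kernelOp_le`, `norm_kernelOp_apply_le`), `summable_triple`, `inner_kernelOp_left`,
`inner_kernelOp_comm`, `inner_kernelOp_fs`, `FinCoercive`, **`inner_kernelOp_self_ge`** (density of finitely supported
vectors), `finCoercive_of_inner_ge`, `norm_le_norm_kernelOp`.  §3 Lax–Milgram packaging [folklore]: `bilin`,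
`isCoercive_bilin`, `norm_le_of_coercive`, **`equivOfCoercive`** (= Mathlib's `IsCoercive.continuousLinearEquivOfBilin`),
`equivOfCoercive_apply`, `apply_symm_apply`, `symm_apply_apply`, `norm_symm_le` (`‖T⁻¹‖ ≤ γ⁻¹`).  §4 the lattice
setting: `KSet`, `idx`, `kerA`, `DecayOn`, `schurBound_kerA`, **`opA`** (+ `opA_apply`, `norm_opA_le`, `opA_symmetric`,
`inner_opA_eq`), **`Hyp56L2`** ((5.6) literally on `l²(Ω)`), `embIdx`, `finCoercive_of_hyp56Z`,
`hyp56Z_coercive_of_finCoercive`, `Hyp56L2.ofZ`, `Hyp56L2.toZ`, **`hyp56L2_iff : Hyp56L2 ↔ Hyp56Z`** (under `0 ≤ c₀`,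
`0 < δ₀`), `inner_opA_self_ge`.  §5 the inverse: **`opAEquiv`** (+ `opAEquiv_apply`, `opA_inv_apply`, `inv_opA_apply`,
`norm_inv_le : ‖(A_Ω)⁻¹‖ ≤ γ₀⁻¹`), **`G`**, `tsum_mul_G`, `abs_G_le`, **`G_eq_limInv : G = limInv Ω A`**, `G_symm`,
`tsum_G_mul`, **`inv_apply_eq_tsum`** (`(A_Ω)⁻¹` is the integral operator of `G`).  §6 headline: `Hyp56L2.mono`,
`abs_G_le_exp` ((5.7)), `G_sub_G_abs_le` ((5.8)), `G_perturb_abs_le` ((5.10)), `Ginv`, `Sect5ThmL2 d N` and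
**`sect5ThmL2_holds : ∀ d N, Sect5ThmL2 d N`**, `sect5ThmSetOmega_of_L2`, non-vacuity `hyp56L2_one`.

## Honest scope / what this does NOT do

* Real scalars only (the printed `R^N`); no complex `l²`.  "Symmetric operator" is read through the kernel
  (`A(x,x′) = A(x′,x)`), from which operator symmetry is PROVED; the converse (a symmetric bounded kernel operator has a
  symmetric kernel) is the evaluation `A(x,x′) = ⟪A δ_{x′}, δ_x⟫` and is not needed.
* No new analysis: the decay statements (5.7)/(5.8)/(5.10) are `…B4Sect5Exhaustion`'s theorems transported along
  `G_eq_limInv`; the constants are `…B4Sect5Proof.(cStar, deltaStar)`; (5.10) keeps `…B4Sect5Exhaustion`'s reading (δ)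
  (`Ω ≠ ℤ^d`, Mathlib's `infDist x ∅ = 0`).  It does not certify the printed random-walk proof, proves nothing about tori,
  rewires no consumer, and asserts nothing of B4 as a fact: every hypothesis of every theorem is (5.6) (on `l²` or in
  kernel form) / (5.9) plus `0 < γ₀, c₀, δ₀`; the non-Mathlib inputs are the sorry-free tree theorems
  `…B4Sect5Exhaustion.{Hyp56Z.mono, sum_expKernel_le, limInv_abs_le, limInv_symm, limInv_sub_limInv_abs_le,
  limInv_perturb_abs_le, eq_limInv_of_right_inverse, hyp56Z_one}`, `…B4Sect5Proof.{latticeConst_nonneg, cStar_pos,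
  deltaStar_pos}` and the DEFINITIONS `…B4Sect5Exhaustion.{K, toMat, Hyp56Z, Hyp59Z, limInv}`, `B4.Idx`
  (ABSOLUTE-RULE census: no programme-internal statement enters).
-/

namespace Literature.MathematicalPhysics.QuantumFieldTheory.Balaban1983to89.B4Sect5L2

open Finset Real Filter Topology
open scoped ENNReal

noncomputable section

/-! ## §1  `ℓ²(ι)` over `ℝ`: notation and three elementary facts [folklore] -/

section L2Basics

variable {ι : Type}

/-- The real Hilbert space `ℓ²(ι)` (Mathlib's `lp (fun _ => ℝ) 2`). [folklore] -/
abbrev H (ι : Type) : Type := lp (fun _ : ι => ℝ) 2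

/-- Squares of an `ℓ²` vector are summable. [folklore] -/
theorem sq_summable (f : H ι) : Summable fun i => f i ^ 2 := by
  have h := (lp.memℓp f).summable (by norm_num : 0 < (2 : ℝ≥0∞).toReal)
  simpa using h

/-- `‖f‖² = Σ_i f(i)²`. [folklore] -/
theorem norm_sq_eq_tsum (f : H ι) : ‖f‖ ^ 2 = ∑' i, f i ^ 2 := by
  have h := lp.norm_rpow_eq_tsum (p := 2) (by norm_num) f
  simpa using h

/-- Each coordinate is bounded by the norm. [folklore] -/
theorem abs_apply_le_norm (f : H ι) (i : ι) : |f i| ≤ ‖f‖ := by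
  have h := lp.norm_apply_le_norm (p := 2) (by norm_num) f i
  simpa using h

/-- Partial sums of squares are bounded by `‖f‖²`. [folklore] -/
theorem sum_sq_le_norm_sq (f : H ι) (s : Finset ι) : ∑ i ∈ s, f i ^ 2 ≤ ‖f‖ ^ 2 := by
  rw [norm_sq_eq_tsum]
  exact (sq_summable f).sum_le_tsum s (fun _ _ => sq_nonneg _)

/-- The real inner product of `ℓ²(ι)` is `Σ_i f(i) g(i)`. [folklore] -/
theorem inner_eq_tsum (f g : H ι) : inner ℝ f g = ∑' i, f i * g i := by
  rw [lp.inner_eq_tsum]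
  exact tsum_congr fun i => by simp [mul_comm]

/-- The products `f(i) g(i)` are summable. [folklore] -/
theorem summable_mul_apply (f g : H ι) : Summable fun i => f i * g i := by
  have h := lp.summable_inner (𝕜 := ℝ) f g
  refine h.congr fun i => ?_
  simp [mul_comm]

end L2Basics

section FinSupp

variable {ι : Type} [DecidableEq ι]

/-- The finitely supported vector with prescribed values `c` on a finite set `s` (zero elsewhere). [folklore] -/
def fs (s : Finset ι) (c : ι → ℝ) : H ι :=
  ⟨fun i => if i ∈ s then c i else 0, by
    refine memℓp_gen' (C := ∑ i ∈ s, c i ^ 2) fun t => ?_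
    have h : ∑ i ∈ t, (if i ∈ s then c i else 0) ^ 2 ≤ ∑ i ∈ s, c i ^ 2 := by
      calc ∑ i ∈ t, (if i ∈ s then c i else 0) ^ 2 = ∑ i ∈ t, (if i ∈ s then c i ^ 2 else 0) :=
            Finset.sum_congr rfl fun i _ => by split_ifs <;> simp
        _ = ∑ i ∈ t ∩ s, c i ^ 2 := Finset.sum_ite_mem t s _
        _ ≤ ∑ i ∈ s, c i ^ 2 :=
            Finset.sum_le_sum_of_subset_of_nonneg Finset.inter_subset_right (fun _ _ _ => sq_nonneg _)
    simpa [Real.norm_eq_abs, sq_abs] using h⟩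

/-- Values of the finitely supported vector. [folklore] -/
@[simp] theorem fs_apply (s : Finset ι) (c : ι → ℝ) (i : ι) : fs s c i = if i ∈ s then c i else 0 := rfl

/-- The partial sums of the coordinate expansion of `f ∈ ℓ²` are the truncations `fs s f`. [folklore] -/
theorem sum_single_eq_fs (f : H ι) (s : Finset ι) :
    ∑ i ∈ s, lp.single 2 i (f i) = fs s (⇑f) := by
  refine lp.ext (funext fun j => ?_)
  rw [lp.coeFn_sum]
  simp [Finset.sum_apply, lp.single_apply, Finset.sum_pi_single]

/-- Truncations converge in `ℓ²`: `fs s f → f` along finite sets `s ↑ ι`. [folklore] -/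
theorem tendsto_fs (f : H ι) : Tendsto (fun s : Finset ι => fs s (⇑f)) atTop (𝓝 f) := by
  have h : HasSum (fun i => lp.single 2 i (f i)) f := lp.hasSum_single (by norm_num) f
  have h' : Tendsto (fun s : Finset ι => ∑ i ∈ s, lp.single 2 i (f i)) atTop (𝓝 f) := h
  refine h'.congr fun s => ?_
  exact sum_single_eq_fs f s

/-- `‖fs s c‖² = Σ_{i∈s} c(i)²`. [folklore] -/
theorem norm_fs_sq (s : Finset ι) (c : ι → ℝ) : ‖fs s c‖ ^ 2 = ∑ i ∈ s, c i ^ 2 := by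
  rw [norm_sq_eq_tsum, tsum_eq_sum (s := s) (fun i hi => by simp [hi])]
  exact Finset.sum_congr rfl fun i hi => by simp [hi]

/-- A `tsum` against a finitely supported vector is a finite sum. [folklore] -/
theorem tsum_mul_fs (s : Finset ι) (c : ι → ℝ) (g : ι → ℝ) :
    ∑' j, g j * fs s c j = ∑ j ∈ s, g j * c j := by
  rw [tsum_eq_sum (s := s) (fun j hj => by simp [hj])]
  exact Finset.sum_congr rfl fun j hj => by simp [hj]

end FinSupp

/-! ## §2  Schur's test: kernels with bounded row and column sums act boundedly on `ℓ²(ι)` [folklore] -/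

section Schur

variable {ι : Type} {k : ι → ι → ℝ} {M : ℝ}

/-- **Schur bound** for a real kernel on `ι`: `0 ≤ M` and every row and column partial `ℓ¹`-sum is `≤ M`.
[folklore] -/
def SchurBound (k : ι → ι → ℝ) (M : ℝ) : Prop :=
  0 ≤ M ∧ (∀ (i : ι) (s : Finset ι), ∑ j ∈ s, |k i j| ≤ M) ∧ (∀ (j : ι) (s : Finset ι), ∑ i ∈ s, |k i j| ≤ M)

namespace SchurBound

/-- Rows are absolutely summable. [folklore] -/
theorem summable_row (h : SchurBound k M) (i : ι) : Summable fun j => |k i j| :=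
  summable_of_sum_le (fun _ => abs_nonneg _) (h.2.1 i)

/-- Row sums are `≤ M`. [folklore] -/
theorem tsum_row_le (h : SchurBound k M) (i : ι) : ∑' j, |k i j| ≤ M :=
  Real.tsum_le_of_sum_le (fun _ => abs_nonneg _) (h.2.1 i)

/-- The transposed kernel has the same Schur bound. [folklore] -/
theorem transpose (h : SchurBound k M) : SchurBound (fun i j => k j i) M :=
  ⟨h.1, fun i s => h.2.2 i s, fun j s => h.2.1 j s⟩

/-- `j ↦ k(i,j) f(j)` is summable for `f ∈ ℓ²`. [folklore] -/
theorem summable_row_mul (h : SchurBound k M) (f : H ι) (i : ι) : Summable fun j => k i j * f j := by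
  refine Summable.of_norm_bounded ((h.summable_row i).mul_right ‖f‖) fun j => ?_
  rw [Real.norm_eq_abs, abs_mul]
  exact mul_le_mul_of_nonneg_left (abs_apply_le_norm f j) (abs_nonneg _)

/-- `j ↦ |k(i,j)| f(j)²` is summable for `f ∈ ℓ²`. [folklore] -/
theorem summable_row_abs_mul_sq (h : SchurBound k M) (f : H ι) (i : ι) :
    Summable fun j => |k i j| * f j ^ 2 := by
  refine Summable.of_nonneg_of_le (fun j => by positivity) (fun j => ?_) ((h.summable_row i).mul_right (‖f‖ ^ 2))
  refine mul_le_mul_of_nonneg_left ?_ (abs_nonneg _)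
  have := abs_apply_le_norm f j
  rw [← sq_abs]
  exact pow_le_pow_left₀ (abs_nonneg _) this 2

end SchurBound

/-- The pointwise action `(k f)(i) = Σ_j k(i,j) f(j)`. [folklore] -/
def act (k : ι → ι → ℝ) (f : H ι) : ι → ℝ := fun i => ∑' j, k i j * f j

/-- **Schur, pointwise**: `(k f)(i)² ≤ M · Σ_j |k(i,j)| f(j)²` (Cauchy–Schwarz with weights `|k(i,·)|`).
[folklore] -/
theorem act_sq_le (h : SchurBound k M) (f : H ι) (i : ι) :
    act k f i ^ 2 ≤ M * ∑' j, |k i j| * f j ^ 2 := by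
  set C := M * ∑' j, |k i j| * f j ^ 2 with hCdef
  have hT : 0 ≤ ∑' j, |k i j| * f j ^ 2 := tsum_nonneg fun j => by positivity
  have hC : 0 ≤ C := mul_nonneg h.1 hT
  -- finite Cauchy–Schwarz: (Σ_s |k||f|)² ≤ (Σ_s |k|)(Σ_s |k| f²) ≤ C
  have hsq : ∀ s : Finset ι, (∑ j ∈ s, |k i j| * |f j|) ^ 2 ≤ C := by
    intro s
    have hcs := Finset.sum_mul_sq_le_sq_mul_sq s (fun j => Real.sqrt |k i j|) (fun j => Real.sqrt |k i j| * |f j|)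
    have h1 : ∀ j, Real.sqrt |k i j| * (Real.sqrt |k i j| * |f j|) = |k i j| * |f j| := fun j => by
      rw [← mul_assoc, Real.mul_self_sqrt (abs_nonneg _)]
    have h2 : ∀ j, Real.sqrt |k i j| ^ 2 = |k i j| := fun j => Real.sq_sqrt (abs_nonneg _)
    have h3 : ∀ j, (Real.sqrt |k i j| * |f j|) ^ 2 = |k i j| * f j ^ 2 := fun j => by
      rw [mul_pow, Real.sq_sqrt (abs_nonneg _), sq_abs]
    simp only [h1, h2, h3] at hcs
    refine hcs.trans ?_
    exact mul_le_mul (h.2.1 i s) ((h.summable_row_abs_mul_sq f i).sum_le_tsum s fun _ _ => by positivity)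
      (Finset.sum_nonneg fun _ _ => by positivity) h.1
  have hpart : ∀ s : Finset ι, ∑ j ∈ s, |k i j| * |f j| ≤ Real.sqrt C := by
    intro s
    have hs0 : 0 ≤ ∑ j ∈ s, |k i j| * |f j| := Finset.sum_nonneg fun _ _ => by positivity
    exact (Real.le_sqrt hs0 hC).2 (hsq s)
  have htsum : ∑' j, |k i j| * |f j| ≤ Real.sqrt C :=
    Real.tsum_le_of_sum_le (fun _ => by positivity) hpart
  have habs : |act k f i| ≤ ∑' j, |k i j| * |f j| := by
    have hs : Summable fun j => ‖k i j * f j‖ := by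
      simpa [Real.norm_eq_abs, abs_mul] using ((h.summable_row_mul f i).abs)
    have := norm_tsum_le_tsum_norm hs
    simpa [act, Real.norm_eq_abs, abs_mul] using this
  have h0 : 0 ≤ ∑' j, |k i j| * |f j| := tsum_nonneg fun _ => by positivity
  calc act k f i ^ 2 = |act k f i| ^ 2 := (sq_abs _).symm
    _ ≤ (∑' j, |k i j| * |f j|) ^ 2 := pow_le_pow_left₀ (abs_nonneg _) habs 2
    _ ≤ Real.sqrt C ^ 2 := pow_le_pow_left₀ h0 htsum 2
    _ = C := Real.sq_sqrt hC

/-- **Schur, in norm**: `Σ_{i∈s} (k f)(i)² ≤ M² ‖f‖²` for every finite `s`. [folklore] -/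
theorem sum_act_sq_le (h : SchurBound k M) (f : H ι) (s : Finset ι) :
    ∑ i ∈ s, act k f i ^ 2 ≤ M ^ 2 * ‖f‖ ^ 2 := by
  calc ∑ i ∈ s, act k f i ^ 2 ≤ ∑ i ∈ s, M * ∑' j, |k i j| * f j ^ 2 :=
        Finset.sum_le_sum fun i _ => act_sq_le h f i
    _ = M * ∑' j, ∑ i ∈ s, |k i j| * f j ^ 2 := by
        rw [← Finset.mul_sum, Summable.tsum_finsetSum (fun i _ => h.summable_row_abs_mul_sq f i)]
    _ ≤ M * ∑' j, M * f j ^ 2 := by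
        refine mul_le_mul_of_nonneg_left ?_ h.1
        refine Summable.tsum_le_tsum (fun j => ?_) (summable_sum fun i _ => h.summable_row_abs_mul_sq f i)
          ((sq_summable f).mul_left M)
        rw [← Finset.sum_mul]
        exact mul_le_mul_of_nonneg_right (h.2.2 j s) (sq_nonneg _)
    _ = M ^ 2 * ‖f‖ ^ 2 := by rw [tsum_mul_left, norm_sq_eq_tsum]; ring

/-- The image of an `ℓ²` vector under a Schur-bounded kernel is in `ℓ²`. [folklore] -/
theorem memℓp_act (h : SchurBound k M) (f : H ι) : Memℓp (act k f) 2 := by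
  refine memℓp_gen' (C := M ^ 2 * ‖f‖ ^ 2) fun s => ?_
  simpa [Real.norm_eq_abs, sq_abs] using sum_act_sq_le h f s

/-- The action as a map `ℓ² → ℓ²`. [folklore] -/
def actLp (h : SchurBound k M) (f : H ι) : H ι := ⟨act k f, memℓp_act h f⟩

/-- Coordinates of the action. [folklore] -/
@[simp] theorem actLp_apply (h : SchurBound k M) (f : H ι) (i : ι) : actLp h f i = ∑' j, k i j * f j := rfl

/-- Additivity of the action. [folklore] -/
theorem actLp_add (h : SchurBound k M) (f g : H ι) : actLp h (f + g) = actLp h f + actLp h g := by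
  refine lp.ext (funext fun i => ?_)
  simp only [lp.coeFn_add, Pi.add_apply, actLp_apply, mul_add]
  exact (h.summable_row_mul f i).tsum_add (h.summable_row_mul g i)

/-- Homogeneity of the action. [folklore] -/
theorem actLp_smul (h : SchurBound k M) (c : ℝ) (f : H ι) : actLp h (c • f) = c • actLp h f := by
  refine lp.ext (funext fun i => ?_)
  simp only [lp.coeFn_smul, Pi.smul_apply, actLp_apply, smul_eq_mul]
  rw [← tsum_mul_left]
  exact tsum_congr fun j => by ring

/-- The norm bound `‖k f‖ ≤ M ‖f‖`. [folklore] -/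
theorem norm_actLp_le (h : SchurBound k M) (f : H ι) : ‖actLp h f‖ ≤ M * ‖f‖ := by
  refine lp.norm_le_of_forall_sum_le (by norm_num) (mul_nonneg h.1 (norm_nonneg _)) fun s => ?_
  have := sum_act_sq_le h f s
  simpa [Real.norm_eq_abs, sq_abs, mul_pow, act] using this

/-- **Schur's test**: the kernel operator `f ↦ (i ↦ Σ_j k(i,j) f(j))` as a bounded operator on `ℓ²(ι)`,
with `‖kernelOp‖ ≤ M`. [folklore] -/
def kernelOp (h : SchurBound k M) : H ι →L[ℝ] H ι :=
  LinearMap.mkContinuous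
    { toFun := actLp h
      map_add' := actLp_add h
      map_smul' := actLp_smul h } M (norm_actLp_le h)

/-- Coordinates of `kernelOp`. [folklore] -/
@[simp] theorem kernelOp_apply (h : SchurBound k M) (f : H ι) (i : ι) : kernelOp h f i = ∑' j, k i j * f j := rfl

/-- `‖kernelOp‖ ≤ M`. [folklore] -/
theorem norm_kernelOp_le (h : SchurBound k M) : ‖kernelOp h‖ ≤ M :=
  LinearMap.mkContinuous_norm_le _ h.1 _

/-- `‖kernelOp f‖ ≤ M ‖f‖`. [folklore] -/
theorem norm_kernelOp_apply_le (h : SchurBound k M) (f : H ι) : ‖kernelOp h f‖ ≤ M * ‖f‖ :=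
  norm_actLp_le h f

/-- The triple products `g(i) k(i,j) f(j)` are absolutely summable on `ι × ι` (by `|g f| ≤ (g² + f²)/2` and the
Schur bound). [folklore] -/
theorem summable_triple (h : SchurBound k M) (f g : H ι) :
    Summable fun x : ι × ι => g x.1 * (k x.1 x.2 * f x.2) := by
  classical
  refine Summable.of_norm_bounded (g := fun x : ι × ι => |k x.1 x.2| * (g x.1 ^ 2 + f x.2 ^ 2) / 2) ?_
    fun x => ?_
  · refine summable_of_sum_le (fun x => by positivity) (c := M * (‖g‖ ^ 2 + ‖f‖ ^ 2) / 2) fun S => ?_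
    calc ∑ x ∈ S, |k x.1 x.2| * (g x.1 ^ 2 + f x.2 ^ 2) / 2
        ≤ ∑ x ∈ (S.image Prod.fst) ×ˢ (S.image Prod.snd), |k x.1 x.2| * (g x.1 ^ 2 + f x.2 ^ 2) / 2 :=
          Finset.sum_le_sum_of_subset_of_nonneg Finset.subset_product (fun _ _ _ => by positivity)
      _ = (∑ i ∈ S.image Prod.fst, g i ^ 2 * ∑ j ∈ S.image Prod.snd, |k i j|) / 2
          + (∑ j ∈ S.image Prod.snd, f j ^ 2 * ∑ i ∈ S.image Prod.fst, |k i j|) / 2 := by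
          rw [Finset.sum_product]
          have : ∀ i j : ι, |k i j| * (g i ^ 2 + f j ^ 2) / 2 = g i ^ 2 * |k i j| / 2 + f j ^ 2 * |k i j| / 2 :=
            fun i j => by ring
          simp only [this, Finset.sum_add_distrib, Finset.sum_div, Finset.mul_sum]
          congr 1
          rw [Finset.sum_comm]
      _ ≤ (∑ i ∈ S.image Prod.fst, g i ^ 2 * M) / 2 + (∑ j ∈ S.image Prod.snd, f j ^ 2 * M) / 2 := by
          gcongr with i _ j _
          · exact h.2.1 i _
          · exact h.2.2 j _
      _ ≤ (‖g‖ ^ 2 * M) / 2 + (‖f‖ ^ 2 * M) / 2 := by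
          rw [← Finset.sum_mul, ← Finset.sum_mul]
          gcongr
          · exact h.1
          · exact sum_sq_le_norm_sq g _
          · exact h.1
          · exact sum_sq_le_norm_sq f _
      _ = M * (‖g‖ ^ 2 + ‖f‖ ^ 2) / 2 := by ring
  · rw [Real.norm_eq_abs, abs_mul, abs_mul]
    have h2 : |g x.1| * |f x.2| ≤ (g x.1 ^ 2 + f x.2 ^ 2) / 2 := by
      nlinarith [sq_nonneg (|g x.1| - |f x.2|), sq_abs (g x.1), sq_abs (f x.2)]
    calc |g x.1| * (|k x.1 x.2| * |f x.2|) = |k x.1 x.2| * (|g x.1| * |f x.2|) := by ring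
      _ ≤ |k x.1 x.2| * ((g x.1 ^ 2 + f x.2 ^ 2) / 2) := mul_le_mul_of_nonneg_left h2 (abs_nonneg _)
      _ = |k x.1 x.2| * (g x.1 ^ 2 + f x.2 ^ 2) / 2 := by ring

/-- The quadratic/bilinear form of `kernelOp` as an absolutely convergent double sum. [folklore] -/
theorem inner_kernelOp_left (h : SchurBound k M) (f g : H ι) :
    inner ℝ (kernelOp h f) g = ∑' x : ι × ι, g x.1 * (k x.1 x.2 * f x.2) := by
  rw [inner_eq_tsum, (summable_triple h f g).tsum_prod]
  refine tsum_congr fun i => ?_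
  rw [kernelOp_apply, mul_comm, ← tsum_mul_left]

/-- A symmetric Schur-bounded kernel gives a symmetric operator: `⟪k f, g⟫ = ⟪f, k g⟫`. [folklore] -/
theorem inner_kernelOp_comm (h : SchurBound k M) (hk : ∀ i j, k i j = k j i) (f g : H ι) :
    inner ℝ (kernelOp h f) g = inner ℝ f (kernelOp h g) := by
  rw [real_inner_comm (kernelOp h g) f, inner_kernelOp_left h f g, inner_kernelOp_left h g f,
    ← (Equiv.prodComm ι ι).tsum_eq]
  refine tsum_congr fun x => ?_
  simp only [Equiv.prodComm_apply, Prod.fst_swap, Prod.snd_swap]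
  rw [hk x.2 x.1]; ring

section FinSupport

variable [DecidableEq ι]

/-- The quadratic form on a finitely supported vector is the finite double sum. [folklore] -/
theorem inner_kernelOp_fs (h : SchurBound k M) (s : Finset ι) (c : ι → ℝ) :
    inner ℝ (kernelOp h (fs s c)) (fs s c) = ∑ i ∈ s, c i * ∑ j ∈ s, k i j * c j := by
  rw [← real_inner_comm, inner_eq_tsum]
  rw [tsum_eq_sum (s := s) (fun i hi => by simp [hi])]
  refine Finset.sum_congr rfl fun i hi => ?_
  rw [fs_apply, if_pos hi, kernelOp_apply, tsum_mul_fs]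

/-! ### Coercivity: finitely supported vectors suffice -/

/-- Coercivity of the kernel on finitely supported vectors: `γ Σ_s c² ≤ Σ_{i,j∈s} c(i) k(i,j) c(j)`. [folklore] -/
def FinCoercive (k : ι → ι → ℝ) (γ : ℝ) : Prop :=
  ∀ (s : Finset ι) (c : ι → ℝ), γ * ∑ i ∈ s, c i ^ 2 ≤ ∑ i ∈ s, c i * ∑ j ∈ s, k i j * c j

/-- **Density step**: coercivity on finitely supported vectors implies `γ‖f‖² ≤ ⟪k f, f⟫` on all of `ℓ²(ι)`
(truncations `fs s f → f`, continuity of the form). [folklore] -/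
theorem inner_kernelOp_self_ge (h : SchurBound k M) {γ : ℝ} (hfin : FinCoercive k γ) (f : H ι) :
    γ * ‖f‖ ^ 2 ≤ inner ℝ (kernelOp h f) f := by
  have hQ : Continuous fun g : H ι => inner ℝ (kernelOp h g) g - γ * ‖g‖ ^ 2 := by
    have h1 : Continuous fun g : H ι => inner ℝ (kernelOp h g) g :=
      Continuous.inner ((kernelOp h).continuous) continuous_id
    exact h1.sub (continuous_const.mul (continuous_norm.pow 2))
  have hge : ∀ s : Finset ι, 0 ≤ inner ℝ (kernelOp h (fs s (⇑f))) (fs s (⇑f)) - γ * ‖fs s (⇑f)‖ ^ 2 := by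
    intro s
    rw [inner_kernelOp_fs, norm_fs_sq]
    linarith [hfin s (⇑f)]
  have hlim := (hQ.tendsto f).comp (tendsto_fs f)
  have := ge_of_tendsto' hlim (fun s => hge s)
  linarith

/-- Conversely, `ℓ²`-coercivity restricted to finitely supported vectors is `FinCoercive`. [folklore] -/
theorem finCoercive_of_inner_ge (h : SchurBound k M) {γ : ℝ}
    (hco : ∀ f : H ι, γ * ‖f‖ ^ 2 ≤ inner ℝ (kernelOp h f) f) : FinCoercive k γ := by
  intro s c
  have := hco (fs s c)
  rwa [inner_kernelOp_fs, norm_fs_sq] at this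

end FinSupport

/-- Coercivity gives a lower bound on the operator: `γ‖f‖ ≤ ‖k f‖`. [folklore] -/
theorem norm_le_norm_kernelOp (h : SchurBound k M) {γ : ℝ}
    (hco : ∀ f : H ι, γ * ‖f‖ ^ 2 ≤ inner ℝ (kernelOp h f) f) (f : H ι) : γ * ‖f‖ ≤ ‖kernelOp h f‖ := by
  by_cases hf : f = 0
  · simp [hf]
  have hpos : 0 < ‖f‖ := norm_pos_iff.2 hf
  have h1 : γ * ‖f‖ ^ 2 ≤ ‖kernelOp h f‖ * ‖f‖ :=
    (hco f).trans (real_inner_le_norm _ _)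
  nlinarith

end Schur

/-! ## §3  Coercive bounded operators on a real Hilbert space: Lax–Milgram packaging [folklore] -/

section LaxMilgram

variable {V : Type} [NormedAddCommGroup V] [InnerProductSpace ℝ V]

/-- The bounded bilinear form `(v, w) ↦ ⟪T v, w⟫` of a bounded operator. [folklore] -/
def bilin (T : V →L[ℝ] V) : V →L[ℝ] V →L[ℝ] ℝ :=
  LinearMap.mkContinuous₂
    (LinearMap.mk₂ ℝ (fun v w => inner ℝ (T v) w)
      (fun v₁ v₂ w => by rw [map_add, inner_add_left])
      (fun c v w => by rw [map_smul, real_inner_smul_left, smul_eq_mul])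
      (fun v w₁ w₂ => by rw [inner_add_right])
      (fun c v w => by rw [real_inner_smul_right, smul_eq_mul]))
    ‖T‖ (fun v w => by
      calc ‖inner ℝ (T v) w‖ ≤ ‖T v‖ * ‖w‖ := norm_inner_le_norm _ _
        _ ≤ ‖T‖ * ‖v‖ * ‖w‖ := mul_le_mul_of_nonneg_right (T.le_opNorm v) (norm_nonneg _))

/-- Values of the bilinear form. [folklore] -/
@[simp] theorem bilin_apply (T : V →L[ℝ] V) (v w : V) : bilin T v w = inner ℝ (T v) w := rfl

/-- A `γ`-coercive bounded operator (`γ‖v‖² ≤ ⟪T v, v⟫`, `0 < γ`) has a coercive bilinear form. [folklore] -/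
theorem isCoercive_bilin {T : V →L[ℝ] V} {γ : ℝ} (hγ : 0 < γ) (hco : ∀ v, γ * ‖v‖ ^ 2 ≤ inner ℝ (T v) v) :
    IsCoercive (bilin T) :=
  ⟨γ, hγ, fun u => by rw [bilin_apply, mul_assoc, ← sq]; exact hco u⟩

/-- Coercivity bounds the operator from below: `γ‖v‖ ≤ ‖T v‖`. [folklore] -/
theorem norm_le_of_coercive (T : V →L[ℝ] V) {γ : ℝ} (hco : ∀ v, γ * ‖v‖ ^ 2 ≤ inner ℝ (T v) v) (v : V) :
    γ * ‖v‖ ≤ ‖T v‖ := by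
  by_cases hv : v = 0
  · simp [hv]
  have hpos : 0 < ‖v‖ := norm_pos_iff.2 hv
  have h1 : γ * ‖v‖ ^ 2 ≤ ‖T v‖ * ‖v‖ := (hco v).trans (real_inner_le_norm _ _)
  nlinarith

variable [CompleteSpace V]

/-- **Lax–Milgram**: a coercive bounded operator on a real Hilbert space is a continuous linear equivalence
(Mathlib's `IsCoercive.continuousLinearEquivOfBilin`). [folklore] -/
def equivOfCoercive (T : V →L[ℝ] V) {γ : ℝ} (hγ : 0 < γ) (hco : ∀ v, γ * ‖v‖ ^ 2 ≤ inner ℝ (T v) v) :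
    V ≃L[ℝ] V :=
  (isCoercive_bilin hγ hco).continuousLinearEquivOfBilin

/-- The Lax–Milgram equivalence IS the operator. [folklore] -/
@[simp] theorem equivOfCoercive_apply (T : V →L[ℝ] V) {γ : ℝ} (hγ : 0 < γ)
    (hco : ∀ v, γ * ‖v‖ ^ 2 ≤ inner ℝ (T v) v) (v : V) : equivOfCoercive T hγ hco v = T v := by
  refine ext_inner_right ℝ fun w => ?_
  rw [equivOfCoercive, IsCoercive.continuousLinearEquivOfBilin_apply, bilin_apply]

/-- `T ∘ T⁻¹ = id`. [folklore] -/
theorem apply_symm_apply (T : V →L[ℝ] V) {γ : ℝ} (hγ : 0 < γ)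
    (hco : ∀ v, γ * ‖v‖ ^ 2 ≤ inner ℝ (T v) v) (w : V) : T ((equivOfCoercive T hγ hco).symm w) = w := by
  rw [← equivOfCoercive_apply T hγ hco, ContinuousLinearEquiv.apply_symm_apply]

/-- `T⁻¹ ∘ T = id`. [folklore] -/
theorem symm_apply_apply (T : V →L[ℝ] V) {γ : ℝ} (hγ : 0 < γ)
    (hco : ∀ v, γ * ‖v‖ ^ 2 ≤ inner ℝ (T v) v) (v : V) : (equivOfCoercive T hγ hco).symm (T v) = v := by
  rw [← equivOfCoercive_apply T hγ hco, ContinuousLinearEquiv.symm_apply_apply]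

/-- `‖T⁻¹‖ ≤ γ⁻¹`. [folklore] -/
theorem norm_symm_le (T : V →L[ℝ] V) {γ : ℝ} (hγ : 0 < γ) (hco : ∀ v, γ * ‖v‖ ^ 2 ≤ inner ℝ (T v) v) :
    ‖((equivOfCoercive T hγ hco).symm : V →L[ℝ] V)‖ ≤ γ⁻¹ := by
  refine ContinuousLinearMap.opNorm_le_bound _ (inv_nonneg.2 hγ.le) fun w => ?_
  have h := norm_le_of_coercive T hco ((equivOfCoercive T hγ hco).symm w)
  rw [apply_symm_apply] at h
  rw [ContinuousLinearEquiv.coe_coe, inv_mul_eq_div, le_div_iff₀ hγ, mul_comm]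
  exact h

end LaxMilgram

/-! ## §4  The lattice setting of B4 Sect. 5: `L²(Ω; ℝ^N)` for `Ω ⊂ ℤ^d`, the operator `A_Ω`, and (5.6) on `l²(Ω)` -/

section Lattice

open B4Sect5Exhaustion
open B4Sect5Proof (cStar deltaStar latticeConst latticeConst_nonneg cStar_pos deltaStar_pos)

variable {d N : ℕ}

/-- The index set of `L²(Ω; ℝ^N)` — pairs (site of `Ω`, component) — inside the ambient `K d N`. [folklore] -/
def KSet (N : ℕ) (Ω : Set (Fin d → ℤ)) : Set (K d N) := {p | p.1 ∈ Ω}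

/-- Membership in the index set. [folklore] -/
@[simp] theorem mem_KSet {N : ℕ} {Ω : Set (Fin d → ℤ)} {p : K d N} : p ∈ KSet N Ω ↔ p.1 ∈ Ω := Iff.rfl

/-- The index TYPE of `l²(Ω) = L²(Ω; ℝ^N)`. [folklore] -/
abbrev idx (N : ℕ) (Ω : Set (Fin d → ℤ)) : Type := ↥(KSet N Ω)

/-- The kernel `A(x, x′)`, `x, x′ ∈ Ω`, as a kernel on the index type of `l²(Ω)`. [folklore] -/
def kerA (Ω : Set (Fin d → ℤ)) (A : K d N → K d N → ℝ) : idx N Ω → idx N Ω → ℝ := fun i j => A i.1 j.1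

/-- The entry bound of (5.6): `|A(x,x′)| ≤ c₀ e^{−δ₀|x−x′|}` on `Ω`. [cite: Balaban1983RegularityDecay, (5.6) p.594] -/
def DecayOn (Ω : Set (Fin d → ℤ)) (A : K d N → K d N → ℝ) (c₀ δ₀ : ℝ) : Prop :=
  ∀ p q : K d N, p.1 ∈ Ω → q.1 ∈ Ω → |A p q| ≤ c₀ * Real.exp (-(δ₀ * dist p.1 q.1))

variable {Ω : Set (Fin d → ℤ)} {A : K d N → K d N → ℝ} {γ₀ c₀ δ₀ : ℝ}

/-- The (5.6) entry bound gives the Schur bound `c₀ · N · K_d(δ₀)` (lattice sums `B4Sect5Exhaustion.sum_expKernel_le`).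
[folklore] -/
theorem schurBound_kerA (hdec : DecayOn Ω A c₀ δ₀) (hc : 0 ≤ c₀) (hδ : 0 < δ₀) :
    SchurBound (kerA Ω A) (c₀ * (N * latticeConst d δ₀)) := by
  have hrow : ∀ (x : Fin d → ℤ) (s : Finset (idx N Ω)) (g : idx N Ω → ℝ),
      (∀ j ∈ s, |g j| ≤ c₀ * Real.exp (-(δ₀ * dist x j.1.1))) → ∑ j ∈ s, |g j| ≤ c₀ * (N * latticeConst d δ₀) := by
    intro x s g hg
    calc ∑ j ∈ s, |g j| ≤ ∑ j ∈ s, c₀ * Real.exp (-(δ₀ * dist x j.1.1)) := Finset.sum_le_sum hg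
      _ = c₀ * ∑ q ∈ s.map (Function.Embedding.subtype _), Real.exp (-(δ₀ * dist x q.1)) := by
          rw [Finset.mul_sum, Finset.sum_map]; rfl
      _ ≤ c₀ * (N * latticeConst d δ₀) := mul_le_mul_of_nonneg_left (sum_expKernel_le hδ x _) hc
  refine ⟨mul_nonneg hc (mul_nonneg (Nat.cast_nonneg _) (latticeConst_nonneg d hδ.le)), fun i s => ?_, fun j s => ?_⟩
  · exact hrow i.1.1 s (fun j => kerA Ω A i j) fun j _ => hdec i.1 j.1 i.2 j.2
  · refine hrow j.1.1 s (fun i => kerA Ω A i j) fun i _ => ?_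
    rw [dist_comm]; exact hdec i.1 j.1 i.2 j.2

/-- **The operator `A_Ω` on `l²(Ω)`** defined by the kernel (bounded by Schur's test; `‖A_Ω‖ ≤ c₀·N·K_d(δ₀)`).
[cite: Balaban1983RegularityDecay, Sect. 5 Theorem p.594 («a symmetric operator defined on the space L²(Ω)»)] -/
def opA (Ω : Set (Fin d → ℤ)) (A : K d N → K d N → ℝ) (hdec : DecayOn Ω A c₀ δ₀) (hc : 0 ≤ c₀) (hδ : 0 < δ₀) :
    H (idx N Ω) →L[ℝ] H (idx N Ω) :=
  kernelOp (schurBound_kerA hdec hc hδ)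

/-- Coordinates of `A_Ω f`: `(A_Ω f)(x) = Σ_{x′∈Ω} A(x,x′) f(x′)`. [folklore] -/
@[simp] theorem opA_apply (hdec : DecayOn Ω A c₀ δ₀) (hc : 0 ≤ c₀) (hδ : 0 < δ₀) (f : H (idx N Ω)) (i : idx N Ω) :
    opA Ω A hdec hc hδ f i = ∑' j : idx N Ω, A i.1 j.1 * f j := rfl

/-- `‖A_Ω‖ ≤ c₀ · N · K_d(δ₀)`. [folklore] -/
theorem norm_opA_le (hdec : DecayOn Ω A c₀ δ₀) (hc : 0 ≤ c₀) (hδ : 0 < δ₀) :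
    ‖opA Ω A hdec hc hδ‖ ≤ c₀ * (N * latticeConst d δ₀) :=
  norm_kernelOp_le _

/-- A kernel symmetric on `Ω` gives a symmetric operator `A_Ω`. [folklore] -/
theorem opA_symmetric (hdec : DecayOn Ω A c₀ δ₀) (hc : 0 ≤ c₀) (hδ : 0 < δ₀)
    (hsymm : ∀ p q : K d N, p.1 ∈ Ω → q.1 ∈ Ω → A p q = A q p) (f g : H (idx N Ω)) :
    inner ℝ (opA Ω A hdec hc hδ f) g = inner ℝ f (opA Ω A hdec hc hδ g) :=
  inner_kernelOp_comm _ (fun i j => hsymm i.1 j.1 i.2 j.2) f g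

/-- The quadratic form of `A_Ω` as the raw double series `Σ_x f(x) Σ_{x′} A(x,x′) f(x′)`. [folklore] -/
theorem inner_opA_eq (hdec : DecayOn Ω A c₀ δ₀) (hc : 0 ≤ c₀) (hδ : 0 < δ₀) (f : H (idx N Ω)) :
    inner ℝ (opA Ω A hdec hc hδ f) f = ∑' i : idx N Ω, f i * ∑' j : idx N Ω, A i.1 j.1 * f j := by
  rw [inner_eq_tsum]
  exact tsum_congr fun i => by rw [opA_apply, mul_comm]

/-- **Condition (5.6) stated LITERALLY on `l²(Ω)`** (p. 594: *"Let Ω ⊂ Z^d and let A be a symmetric operator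
defined on the space L²(Ω) … A ≥ γ₀I, |A(x,x′)| ≤ c₀e^{−δ₀|x−x′|}, x, x′ ∈ Ω. (5.6)"*): the kernel is symmetric and
exponentially bounded on `Ω`, and `⟨f, A f⟩ ≥ γ₀‖f‖²` for EVERY `f ∈ l²(Ω)` (the form written as the double series,
so that the statement does not depend on any construction of this module). [cite: Balaban1983RegularityDecay, (5.6) p.594] -/
structure Hyp56L2 (Ω : Set (Fin d → ℤ)) (A : K d N → K d N → ℝ) (γ₀ c₀ δ₀ : ℝ) : Prop where
  symm : ∀ p q : K d N, p.1 ∈ Ω → q.1 ∈ Ω → A p q = A q p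
  decay : DecayOn Ω A c₀ δ₀
  coercive : ∀ f : H (idx N Ω), γ₀ * ‖f‖ ^ 2 ≤ ∑' i : idx N Ω, f i * ∑' j : idx N Ω, A i.1 j.1 * f j

/-! ### The two finite-dimensional coercivity clauses agree (reindexing `B4.Idx Λ N ↔ idx N Ω`) -/

/-- The embedding of B4's index set `Λ × Fin N` of a finite `Λ ⊆ Ω` into the index type of `l²(Ω)`. [folklore] -/
def embIdx {Λ : Finset (Fin d → ℤ)} (hΛ : (↑Λ : Set (Fin d → ℤ)) ⊆ Ω) : B4.Idx Λ N ↪ idx N Ω :=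
  ⟨fun xa => ⟨((xa.1 : Fin d → ℤ), xa.2), hΛ xa.1.2⟩, fun xa yb h => by
    have h1 := congrArg (fun i : idx N Ω => i.1) h
    simp only [Prod.mk.injEq] at h1
    exact Prod.ext (Subtype.ext h1.1) h1.2⟩

/-- Values of the embedding. [folklore] -/
@[simp] theorem embIdx_apply {Λ : Finset (Fin d → ℤ)} (hΛ : (↑Λ : Set (Fin d → ℤ)) ⊆ Ω) (xa : B4.Idx Λ N) :
    (embIdx hΛ xa : idx N Ω).1 = ((xa.1 : Fin d → ℤ), xa.2) := rfl

/-- B4's finite-`Λ` coercivity clause (`Hyp56Z.coercive`) implies coercivity on finitely supported vectors of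
`l²(Ω)`. [folklore] -/
theorem finCoercive_of_hyp56Z (hA : Hyp56Z Ω A γ₀ c₀ δ₀) : FinCoercive (kerA Ω A) γ₀ := by
  classical
  intro s c
  -- the finite set of sites carrying `s`, and B4's index set over it
  set Λ : Finset (Fin d → ℤ) := s.image fun i => i.1.1 with hΛdef
  have hΛ : (↑Λ : Set (Fin d → ℤ)) ⊆ Ω := by
    intro x hx
    rw [Finset.mem_coe, hΛdef, Finset.mem_image] at hx
    obtain ⟨i, _, rfl⟩ := hx
    exact i.2
  set e : B4.Idx Λ N ↪ idx N Ω := embIdx hΛ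
  set c' : idx N Ω → ℝ := fun i => if i ∈ s then c i else 0 with hc'
  -- `s` lies in the range of `e`
  have hsub : s ⊆ (Finset.univ : Finset (B4.Idx Λ N)).map e := by
    intro i hi
    rw [Finset.mem_map]
    refine ⟨(⟨i.1.1, Finset.mem_image_of_mem _ hi⟩, i.1.2), Finset.mem_univ _, ?_⟩
    exact Subtype.ext rfl
  have hsum : ∀ g : idx N Ω → ℝ, (∀ i, i ∉ s → g i = 0) → ∑ p : B4.Idx Λ N, g (e p) = ∑ i ∈ s, g i := by
    intro g hg
    rw [← Finset.sum_map Finset.univ e g]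
    exact (Finset.sum_subset hsub fun i _ hi => hg i hi).symm
  have h := hA.coercive Λ hΛ (fun p => c' (e p))
  -- left-hand side
  have hL : ∑ p : B4.Idx Λ N, c' (e p) ^ 2 = ∑ i ∈ s, c i ^ 2 := by
    rw [hsum (fun i => c' i ^ 2) (fun i hi => by simp [hc', hi])]
    exact Finset.sum_congr rfl fun i hi => by simp [hc', hi]
  -- right-hand side
  have hinner : ∀ p : B4.Idx Λ N, (toMat Λ A).mulVec (fun q => c' (e q)) p = ∑ j ∈ s, kerA Ω A (e p) j * c j := by
    intro p
    have hk : (toMat Λ A).mulVec (fun q => c' (e q)) p = ∑ x : B4.Idx Λ N, kerA Ω A (e p) (e x) * c' (e x) := rfl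
    rw [hk, hsum (fun j => kerA Ω A (e p) j * c' j) (fun j hj => by simp [hc', hj])]
    refine Finset.sum_congr rfl fun j hj => ?_
    simp [hc', hj]
  have hR : ∑ p : B4.Idx Λ N, c' (e p) * (toMat Λ A).mulVec (fun q => c' (e q)) p
      = ∑ i ∈ s, c i * ∑ j ∈ s, kerA Ω A i j * c j := by
    simp only [hinner]
    rw [hsum (fun i => c' i * ∑ j ∈ s, kerA Ω A i j * c j) (fun i hi => by simp [hc', hi])]
    exact Finset.sum_congr rfl fun i hi => by simp [hc', hi]
  rw [hL, hR] at h
  exact h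

/-- Conversely, coercivity on finitely supported vectors of `l²(Ω)` gives B4's finite-`Λ` clause. [folklore] -/
theorem hyp56Z_coercive_of_finCoercive (hfin : FinCoercive (kerA Ω A) γ₀) (Λ : Finset (Fin d → ℤ))
    (hΛ : (↑Λ : Set (Fin d → ℤ)) ⊆ Ω) (v : B4.Idx Λ N → ℝ) :
    γ₀ * ∑ p, v p ^ 2 ≤ ∑ p, v p * (toMat Λ A).mulVec v p := by
  classical
  set e : B4.Idx Λ N ↪ idx N Ω := embIdx hΛ
  set c : idx N Ω → ℝ := fun i => if h : i.1.1 ∈ Λ then v (⟨i.1.1, h⟩, i.1.2) else 0 with hc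
  have hce : ∀ p : B4.Idx Λ N, c (e p) = v p := by
    intro p
    simp only [hc, e, embIdx_apply]
    rw [dif_pos p.1.2]
  have h := hfin ((Finset.univ : Finset (B4.Idx Λ N)).map e) c
  rw [Finset.sum_map, Finset.sum_map] at h
  simp only [Finset.sum_map, hce] at h
  have hmv : ∀ p : B4.Idx Λ N, ∑ q : B4.Idx Λ N, kerA Ω A (e p) (e q) * v q = (toMat Λ A).mulVec v p :=
    fun p => rfl
  simp only [hmv] at h
  exact h

/-- **(β) discharged**: (5.6) in kernel form (`B4Sect5Exhaustion.Hyp56Z`: coercivity on finitely supported vectors)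
implies (5.6) literally on `l²(Ω)` — density of finitely supported vectors and continuity of the bounded form.
[folklore] -/
theorem Hyp56L2.ofZ (hA : Hyp56Z Ω A γ₀ c₀ δ₀) (hc : 0 ≤ c₀) (hδ : 0 < δ₀) : Hyp56L2 Ω A γ₀ c₀ δ₀ where
  symm := hA.symm
  decay := hA.decay
  coercive f := by
    rw [← inner_opA_eq hA.decay hc hδ]
    exact inner_kernelOp_self_ge _ (finCoercive_of_hyp56Z hA) f

/-- **(β) discharged, converse**: (5.6) literally on `l²(Ω)` implies the kernel form `Hyp56Z`. [folklore] -/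
theorem Hyp56L2.toZ (hA : Hyp56L2 Ω A γ₀ c₀ δ₀) (hc : 0 ≤ c₀) (hδ : 0 < δ₀) : Hyp56Z Ω A γ₀ c₀ δ₀ where
  symm := hA.symm
  decay := hA.decay
  coercive Λ hΛ v := by
    refine hyp56Z_coercive_of_finCoercive (finCoercive_of_inner_ge (schurBound_kerA hA.decay hc hδ) fun f => ?_) Λ hΛ v
    have h := hA.coercive f
    rwa [← inner_opA_eq hA.decay hc hδ] at h

/-- **(5.6) on `l²(Ω)` ⟺ (5.6) in kernel form.** [folklore] -/
theorem hyp56L2_iff (hc : 0 ≤ c₀) (hδ : 0 < δ₀) : Hyp56L2 Ω A γ₀ c₀ δ₀ ↔ Hyp56Z Ω A γ₀ c₀ δ₀ :=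
  ⟨fun h => h.toZ hc hδ, fun h => Hyp56L2.ofZ h hc hδ⟩

/-- Under (5.6), `A_Ω ≥ γ₀ I` as an operator inequality on `l²(Ω)`. [folklore] -/
theorem inner_opA_self_ge (hA : Hyp56Z Ω A γ₀ c₀ δ₀) (hc : 0 ≤ c₀) (hδ : 0 < δ₀) (f : H (idx N Ω)) :
    γ₀ * ‖f‖ ^ 2 ≤ inner ℝ (opA Ω A hA.decay hc hδ f) f :=
  inner_kernelOp_self_ge _ (finCoercive_of_hyp56Z hA) f

end Lattice

/-! ## §5  `(A_Ω)⁻¹` exists on `l²(Ω)` and its kernel `G_Ω` IS the exhaustion limit `limInv Ω A` -/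

section Inverse

open B4Sect5Exhaustion
open B4Sect5Proof (cStar deltaStar latticeConst latticeConst_nonneg cStar_pos deltaStar_pos)

variable {d N : ℕ} {Ω : Set (Fin d → ℤ)} {A : K d N → K d N → ℝ} {γ₀ c₀ δ₀ : ℝ}

/-- **`A_Ω` is invertible on `l²(Ω)`**: the continuous linear equivalence determined by `A_Ω` (Lax–Milgram from
`A_Ω ≥ γ₀I`, `γ₀ > 0`). [cite: Balaban1983RegularityDecay, Sect. 5 Theorem p.594 («let (A_Λ)^{−1} = G_Λ»)] -/
def opAEquiv (hA : Hyp56Z Ω A γ₀ c₀ δ₀) (hγ : 0 < γ₀) (hc : 0 ≤ c₀) (hδ : 0 < δ₀) :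
    H (idx N Ω) ≃L[ℝ] H (idx N Ω) :=
  equivOfCoercive (opA Ω A hA.decay hc hδ) hγ (inner_opA_self_ge hA hc hδ)

/-- The equivalence is `A_Ω`. [folklore] -/
@[simp] theorem opAEquiv_apply (hA : Hyp56Z Ω A γ₀ c₀ δ₀) (hγ : 0 < γ₀) (hc : 0 ≤ c₀) (hδ : 0 < δ₀)
    (f : H (idx N Ω)) : opAEquiv hA hγ hc hδ f = opA Ω A hA.decay hc hδ f :=
  equivOfCoercive_apply _ hγ _ f

/-- `A_Ω (A_Ω)⁻¹ = 1`. [folklore] -/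
theorem opA_inv_apply (hA : Hyp56Z Ω A γ₀ c₀ δ₀) (hγ : 0 < γ₀) (hc : 0 ≤ c₀) (hδ : 0 < δ₀)
    (w : H (idx N Ω)) : opA Ω A hA.decay hc hδ ((opAEquiv hA hγ hc hδ).symm w) = w :=
  apply_symm_apply _ hγ _ w

/-- `(A_Ω)⁻¹ A_Ω = 1`. [folklore] -/
theorem inv_opA_apply (hA : Hyp56Z Ω A γ₀ c₀ δ₀) (hγ : 0 < γ₀) (hc : 0 ≤ c₀) (hδ : 0 < δ₀)
    (f : H (idx N Ω)) : (opAEquiv hA hγ hc hδ).symm (opA Ω A hA.decay hc hδ f) = f :=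
  symm_apply_apply _ hγ _ f

/-- `‖(A_Ω)⁻¹‖ ≤ γ₀⁻¹`. [folklore] -/
theorem norm_inv_le (hA : Hyp56Z Ω A γ₀ c₀ δ₀) (hγ : 0 < γ₀) (hc : 0 ≤ c₀) (hδ : 0 < δ₀) :
    ‖((opAEquiv hA hγ hc hδ).symm : H (idx N Ω) →L[ℝ] H (idx N Ω))‖ ≤ γ₀⁻¹ :=
  norm_symm_le _ hγ _

/-- **The kernel `G_Ω(x, x′)` of `(A_Ω)⁻¹`**: the `x`-coordinate of `(A_Ω)⁻¹ δ_{x′}`.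
[cite: Balaban1983RegularityDecay, Sect. 5 Theorem p.594 («let (A_Λ)^{−1} = G_Λ be its kernel»)] -/
def G (hA : Hyp56Z Ω A γ₀ c₀ δ₀) (hγ : 0 < γ₀) (hc : 0 ≤ c₀) (hδ : 0 < δ₀) (p q : idx N Ω) : ℝ :=
  (opAEquiv hA hγ hc hδ).symm (lp.single 2 q (1 : ℝ)) p

/-- `G_Ω` is a right inverse kernel: `Σ_{r} A(x,r) G_Ω(r,x′) = δ_{x x′}`. [folklore] -/
theorem tsum_mul_G (hA : Hyp56Z Ω A γ₀ c₀ δ₀) (hγ : 0 < γ₀) (hc : 0 ≤ c₀) (hδ : 0 < δ₀) (p q : idx N Ω) :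
    ∑' r : idx N Ω, A p.1 r.1 * G hA hγ hc hδ r q = if p = q then 1 else 0 := by
  have h := congrArg (fun f : H (idx N Ω) => f p) (opA_inv_apply hA hγ hc hδ (lp.single 2 q (1 : ℝ)))
  simp only [opA_apply] at h
  rw [show (fun r => A p.1 r.1 * G hA hγ hc hδ r q) = fun r => A p.1 r.1 * (opAEquiv hA hγ hc hδ).symm
    (lp.single 2 q (1 : ℝ)) r from rfl, h, lp.single_apply, Pi.single_apply]

/-- Entries of `G_Ω` are bounded by `‖(A_Ω)⁻¹‖ ≤ γ₀⁻¹`. [folklore] -/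
theorem abs_G_le (hA : Hyp56Z Ω A γ₀ c₀ δ₀) (hγ : 0 < γ₀) (hc : 0 ≤ c₀) (hδ : 0 < δ₀) (p q : idx N Ω) :
    |G hA hγ hc hδ p q| ≤ γ₀⁻¹ := by
  unfold G
  refine (abs_apply_le_norm _ p).trans ?_
  calc ‖(opAEquiv hA hγ hc hδ).symm (lp.single 2 q (1 : ℝ))‖
      ≤ ‖((opAEquiv hA hγ hc hδ).symm : H (idx N Ω) →L[ℝ] H (idx N Ω))‖ * ‖(lp.single 2 q (1 : ℝ) : H (idx N Ω))‖ :=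
        ((opAEquiv hA hγ hc hδ).symm : H (idx N Ω) →L[ℝ] H (idx N Ω)).le_opNorm _
    _ ≤ γ₀⁻¹ * 1 := by
        refine mul_le_mul (norm_inv_le hA hγ hc hδ) ?_ (norm_nonneg _) (inv_nonneg.2 hγ.le)
        rw [lp.norm_single (by norm_num)]; simp
    _ = γ₀⁻¹ := mul_one _

/-- **(γ) discharged: the kernel of `(A_Ω)⁻¹` IS the exhaustion limit** `limInv Ω A` of `B4Sect5Exhaustion`
(uniqueness of bounded right inverses, `eq_limInv_of_right_inverse`). [folklore] -/
theorem G_eq_limInv (hA : Hyp56Z Ω A γ₀ c₀ δ₀) (hγ : 0 < γ₀) (hc : 0 < c₀) (hδ : 0 < δ₀) (p q : idx N Ω) :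
    G hA hγ hc.le hδ p q = limInv Ω A p.1 q.1 := by
  classical
  -- the ambient zero-extension of `G`
  set D : K d N → K d N → ℝ := fun a b =>
    if h : a.1 ∈ Ω ∧ b.1 ∈ Ω then G hA hγ hc.le hδ ⟨a, h.1⟩ ⟨b, h.2⟩ else 0 with hD
  have hDG : ∀ a b : idx N Ω, D a.1 b.1 = G hA hγ hc.le hδ a b := by
    intro a b
    simp only [hD]
    rw [dif_pos ⟨a.2, b.2⟩]
  have hDM : ∀ a b, |D a b| ≤ γ₀⁻¹ := by
    intro a b
    by_cases h : a.1 ∈ Ω ∧ b.1 ∈ Ω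
    · simp only [hD]; rw [dif_pos h]; exact abs_G_le hA hγ hc.le hδ _ _
    · simp only [hD]; rw [dif_neg h, abs_zero]; exact inv_nonneg.2 hγ.le
  have hD0 : ∀ a b : K d N, a.1 ∉ Ω → D a b = 0 := by
    intro a b ha
    simp only [hD]; rw [dif_neg (fun h => ha h.1)]
  have hAD : ∀ a r : K d N, a.1 ∈ Ω → r.1 ∈ Ω → ∑' b, A a b * D b r = if a = r then 1 else 0 := by
    intro a r ha hr
    have hind : (fun b : K d N => A a b * D b r) = (KSet N Ω).indicator (fun b => A a b * D b r) := by
      funext b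
      by_cases hb : b ∈ KSet N Ω
      · rw [Set.indicator_of_mem hb]
      · rw [Set.indicator_of_notMem hb, hD0 b r hb, mul_zero]
    rw [hind, ← _root_.tsum_subtype (KSet N Ω) (fun b => A a b * D b r)]
    have h := tsum_mul_G hA hγ hc.le hδ ⟨a, ha⟩ ⟨r, hr⟩
    simp only [Subtype.mk.injEq] at h
    rw [← h]
    exact tsum_congr fun b => by rw [← hDG b ⟨r, hr⟩]
  have h := eq_limInv_of_right_inverse hγ hc hδ hA hDM hD0 hAD p.2 q.2
  rwa [hDG] at h

/-- `G_Ω` vanishes nowhere it should not and is symmetric: `G_Ω(x,x′) = G_Ω(x′,x)`. [folklore] -/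
theorem G_symm (hA : Hyp56Z Ω A γ₀ c₀ δ₀) (hγ : 0 < γ₀) (hc : 0 < c₀) (hδ : 0 < δ₀) (p q : idx N Ω) :
    G hA hγ hc.le hδ p q = G hA hγ hc.le hδ q p := by
  rw [G_eq_limInv hA hγ hc hδ, G_eq_limInv hA hγ hc hδ, limInv_symm hγ hc hδ hA]

/-- `G_Ω` is also a LEFT inverse kernel: `Σ_r G_Ω(x,r) A(r,x′) = δ_{x x′}`. [folklore] -/
theorem tsum_G_mul (hA : Hyp56Z Ω A γ₀ c₀ δ₀) (hγ : 0 < γ₀) (hc : 0 < c₀) (hδ : 0 < δ₀) (p q : idx N Ω) :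
    ∑' r : idx N Ω, G hA hγ hc.le hδ p r * A r.1 q.1 = if p = q then 1 else 0 := by
  have h := tsum_mul_G hA hγ hc.le hδ q p
  have hpq : (if p = q then (1 : ℝ) else 0) = if q = p then 1 else 0 := by
    by_cases hpq : p = q
    · subst hpq; rfl
    · rw [if_neg hpq, if_neg (Ne.symm hpq)]
  rw [hpq, ← h]
  exact tsum_congr fun r => by rw [G_symm hA hγ hc hδ p r, hA.symm r.1 q.1 r.2 q.2, mul_comm]

/-- **`(A_Ω)⁻¹` is the integral operator with kernel `G_Ω`**: `((A_Ω)⁻¹ w)(x) = Σ_{x′} G_Ω(x,x′) w(x′)`.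
[folklore] -/
theorem inv_apply_eq_tsum (hA : Hyp56Z Ω A γ₀ c₀ δ₀) (hγ : 0 < γ₀) (hc : 0 ≤ c₀) (hδ : 0 < δ₀)
    (w : H (idx N Ω)) (p : idx N Ω) :
    (opAEquiv hA hγ hc hδ).symm w p = ∑' q : idx N Ω, G hA hγ hc hδ p q * w q := by
  classical
  set E := (opAEquiv hA hγ hc hδ).symm
  -- evaluation at `p` is a continuous linear functional
  set ev : H (idx N Ω) →L[ℝ] ℝ :=
    LinearMap.mkContinuous { toFun := fun f => f p, map_add' := fun f g => rfl, map_smul' := fun c f => rfl } 1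
      (fun f => by simpa using abs_apply_le_norm f p) with hev
  have hsum : HasSum (fun q => lp.single 2 q (w q)) w := lp.hasSum_single (by norm_num) w
  have h2 := (hsum.mapL (E : H (idx N Ω) →L[ℝ] H (idx N Ω))).mapL ev
  simp only [ContinuousLinearEquiv.coe_coe] at h2
  have h3 : ∀ q, ev (E (lp.single 2 q (w q))) = G hA hγ hc hδ p q * w q := by
    intro q
    have hs : (lp.single 2 q (w q) : H (idx N Ω)) = w q • lp.single 2 q (1 : ℝ) := by
      refine lp.ext (funext fun r => ?_)
      rw [lp.coeFn_smul, lp.single_apply, Pi.smul_apply, lp.single_apply, smul_eq_mul]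
      by_cases hrq : r = q
      · subst hrq; simp
      · simp [hrq]
    rw [hs, map_smul, map_smul, smul_eq_mul, mul_comm]
    rfl
  simp only [h3] at h2
  exact (h2.tsum_eq).symm

end Inverse

/-! ## §6  The Sect. 5 Theorem of B4 in `l²`-operator form: (5.7), (5.8), (5.10) for the kernels of `(A_Λ)⁻¹` -/

section Headline

open B4Sect5Exhaustion
open B4Sect5Proof (cStar deltaStar latticeConst latticeConst_nonneg cStar_pos deltaStar_pos)

variable {d N : ℕ} {Ω : Set (Fin d → ℤ)} {A B : K d N → K d N → ℝ} {γ₀ c₀ δ₀ : ℝ}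

/-- (5.6) on `l²(Ω)` restricts to every `Λ ⊆ Ω`: `A_Λ = ΛAΛ` is symmetric, exponentially bounded and `≥ γ₀I` on
`l²(Λ)`. [folklore] -/
theorem Hyp56L2.mono (hA : Hyp56L2 Ω A γ₀ c₀ δ₀) (hc : 0 ≤ c₀) (hδ : 0 < δ₀) {Λ : Set (Fin d → ℤ)} (hΛ : Λ ⊆ Ω) :
    Hyp56L2 Λ A γ₀ c₀ δ₀ :=
  Hyp56L2.ofZ ((hA.toZ hc hδ).mono hΛ) hc hδ

/-- **(5.7) for the kernel of `(A_Ω)⁻¹`**: `|G_Ω(x,x′)| ≤ c₁e^{−δ₁|x−x′|}` with `(c₁, δ₁) = (cStar, deltaStar)`.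
[cite: Balaban1983RegularityDecay, (5.7) p.594] -/
theorem abs_G_le_exp (hA : Hyp56Z Ω A γ₀ c₀ δ₀) (hγ : 0 < γ₀) (hc : 0 < c₀) (hδ : 0 < δ₀) (p q : idx N Ω) :
    |G hA hγ hc.le hδ p q| ≤ cStar d N γ₀ c₀ δ₀ * Real.exp (-(deltaStar d N γ₀ c₀ δ₀ * dist p.1.1 q.1.1)) := by
  rw [G_eq_limInv hA hγ hc hδ]
  exact limInv_abs_le hγ hc hδ hA p.1 q.1

/-- **(5.8) for the kernels of `(A_Λ)⁻¹` and `(A_Ω)⁻¹`**, `Λ ⊆ Ω`: `|G_Λ(x,x′) − G_Ω(x,x′)| ≤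
c₁e^{−δ₁(|x−x′| + dist(x, Λ^c) + dist(x′, Λ^c))}`, `x, x′ ∈ Λ`, `Λ^c = Ω ∖ Λ` (p. 596).
[cite: Balaban1983RegularityDecay, (5.8) p.594] -/
theorem G_sub_G_abs_le (hA : Hyp56Z Ω A γ₀ c₀ δ₀) (hγ : 0 < γ₀) (hc : 0 < c₀) (hδ : 0 < δ₀)
    {Λ : Set (Fin d → ℤ)} (hΛ : Λ ⊆ Ω) (p q : idx N Λ) :
    |G (hA.mono hΛ) hγ hc.le hδ p q - G hA hγ hc.le hδ ⟨p.1, hΛ p.2⟩ ⟨q.1, hΛ q.2⟩| ≤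
      cStar d N γ₀ c₀ δ₀ * Real.exp (-(deltaStar d N γ₀ c₀ δ₀ *
        (dist p.1.1 q.1.1 + Metric.infDist p.1.1 (Ω \ Λ) + Metric.infDist q.1.1 (Ω \ Λ)))) := by
  rw [G_eq_limInv (hA.mono hΛ) hγ hc hδ, G_eq_limInv hA hγ hc hδ]
  exact limInv_sub_limInv_abs_le hγ hc hδ hA hΛ p.2 q.2

/-- **(5.10) for the kernels of `(A_Λ)⁻¹` and `((A+B)_Λ)⁻¹`**, `Λ ⊆ Ω ≠ ℤ^d`, under (5.6) for `A` and `A + B` and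
(5.9) for `B` on `Ω`. [cite: Balaban1983RegularityDecay, (5.10) p.594] -/
theorem G_perturb_abs_le (hA : Hyp56Z Ω A γ₀ c₀ δ₀) (hAB : Hyp56Z Ω (A + B) γ₀ c₀ δ₀) (hB : Hyp59Z Ω B c₀ δ₀)
    (hγ : 0 < γ₀) (hc : 0 < c₀) (hδ : 0 < δ₀) (hΩc : (Ωᶜ : Set (Fin d → ℤ)).Nonempty)
    {Λ : Set (Fin d → ℤ)} (hΛ : Λ ⊆ Ω) (p q : idx N Λ) :
    |G (hA.mono hΛ) hγ hc.le hδ p q - G (hAB.mono hΛ) hγ hc.le hδ p q| ≤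
      cStar d N γ₀ c₀ δ₀ * Real.exp (-(deltaStar d N γ₀ c₀ δ₀ *
        (dist p.1.1 q.1.1 + Metric.infDist p.1.1 Ωᶜ + Metric.infDist q.1.1 Ωᶜ))) := by
  rw [G_eq_limInv (hA.mono hΛ) hγ hc hδ, G_eq_limInv (hAB.mono hΛ) hγ hc hδ]
  exact limInv_perturb_abs_le hγ hc hδ hA hAB hB hΩc hΛ p.2 q.2

/-- The kernel family of the theorem read on `l²`: for (5.6) on `l²(Ω)` and `Λ ⊆ Ω`, `Ginv hA hγ hc hδ hΛ = G_Λ` is the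
kernel of `(A_Λ)⁻¹`, `A_Λ = ΛAΛ` on `l²(Λ)`. [cite: Balaban1983RegularityDecay, Sect. 5 Theorem p.594 («C_Λ = A_Λ^{−1}»)] -/
def Ginv (hA : Hyp56L2 Ω A γ₀ c₀ δ₀) (hγ : 0 < γ₀) (hc : 0 < c₀) (hδ : 0 < δ₀) {Λ : Set (Fin d → ℤ)} (hΛ : Λ ⊆ Ω) :
    idx N Λ → idx N Λ → ℝ :=
  G ((hA.toZ hc.le hδ).mono hΛ) hγ hc.le hδ

/-- **Sect. 5 Theorem of B4 (CMP 89 (1983) p. 594), `l²`-OPERATOR READING, uniform constants.**  For every `Ω ⊂ ℤ^d`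
and every symmetric operator `A` on `l²(Ω) = L²(Ω; ℝ^N)` with (5.6) — `A ≥ γ₀I` on `l²(Ω)`, `|A(x,x′)| ≤ c₀e^{−δ₀|x−x′|}` —
and every `Λ ⊆ Ω`: `A_Λ = ΛAΛ` is a bounded symmetric operator on `l²(Λ)` with `A_Λ ≥ γ₀I`; it is invertible
(a continuous linear equivalence), `‖A_Λ⁻¹‖ ≤ γ₀⁻¹`; `C_Λ = A_Λ⁻¹` is the integral operator of a kernel `G_Λ` which
equals the exhaustion limit `limInv Λ A` of `…B4Sect5Exhaustion`; and `G_Λ` satisfies (5.7), (5.8) (against `G_Ω`,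
`Λ^c = Ω ∖ Λ`) and — for `Ω ≠ ℤ^d`, under (5.6) for `A + B` and (5.9) for `B` — (5.10), with constants `c₁, δ₁`
depending on `γ₀, c₀, δ₀, d, N` only. [cite: Balaban1983RegularityDecay, Sect. 5 Theorem (5.6)–(5.10) p.594 + p.597] -/
def Sect5ThmL2 (d N : ℕ) : Prop :=
  ∀ (γ₀ c₀ δ₀ : ℝ) (hγ : 0 < γ₀) (hc : 0 < c₀) (hδ : 0 < δ₀), ∃ c₁ δ₁ : ℝ, 0 < c₁ ∧ 0 < δ₁ ∧
    ∀ (Ω : Set (Fin d → ℤ)) (A : K d N → K d N → ℝ) (hA : Hyp56L2 Ω A γ₀ c₀ δ₀),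
      (∀ (Λ : Set (Fin d → ℤ)) (hΛ : Λ ⊆ Ω),
        -- `A_Λ = ΛAΛ` on `l²(Λ)`: bounded, symmetric, `≥ γ₀ I`
        (∀ (f : H (idx N Λ)) (i : idx N Λ),
            opA Λ A (hA.mono hc.le hδ hΛ).decay hc.le hδ f i = ∑' j : idx N Λ, A i.1 j.1 * f j) ∧
        ‖opA Λ A (hA.mono hc.le hδ hΛ).decay hc.le hδ‖ ≤ c₀ * (N * latticeConst d δ₀) ∧
        (∀ f g : H (idx N Λ), inner ℝ (opA Λ A (hA.mono hc.le hδ hΛ).decay hc.le hδ f) g =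
            inner ℝ f (opA Λ A (hA.mono hc.le hδ hΛ).decay hc.le hδ g)) ∧
        (∀ f : H (idx N Λ), γ₀ * ‖f‖ ^ 2 ≤ inner ℝ (opA Λ A (hA.mono hc.le hδ hΛ).decay hc.le hδ f) f) ∧
        -- `A_Λ` is invertible: `opAEquiv = A_Λ`, `‖A_Λ⁻¹‖ ≤ γ₀⁻¹`
        (∀ f : H (idx N Λ), opAEquiv ((hA.toZ hc.le hδ).mono hΛ) hγ hc.le hδ f =
            opA Λ A (hA.mono hc.le hδ hΛ).decay hc.le hδ f) ∧
        ‖((opAEquiv ((hA.toZ hc.le hδ).mono hΛ) hγ hc.le hδ).symm : H (idx N Λ) →L[ℝ] H (idx N Λ))‖ ≤ γ₀⁻¹ ∧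
        -- `C_Λ = A_Λ⁻¹` is the integral operator of `G_Λ`, and `G_Λ = limInv Λ A`
        (∀ (w : H (idx N Λ)) (p : idx N Λ), (opAEquiv ((hA.toZ hc.le hδ).mono hΛ) hγ hc.le hδ).symm w p =
            ∑' q : idx N Λ, Ginv hA hγ hc hδ hΛ p q * w q) ∧
        (∀ p q : idx N Λ, Ginv hA hγ hc hδ hΛ p q = limInv Λ A p.1 q.1) ∧
        -- (5.7)
        (∀ p q : idx N Λ, |Ginv hA hγ hc hδ hΛ p q| ≤ c₁ * Real.exp (-(δ₁ * dist p.1.1 q.1.1))) ∧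
        -- (5.8), `δC_Λ = C_Λ − C_Ω`, `Λ^c = Ω ∖ Λ`
        (∀ p q : idx N Λ, |Ginv hA hγ hc hδ hΛ p q - Ginv hA hγ hc hδ subset_rfl ⟨p.1, hΛ p.2⟩ ⟨q.1, hΛ q.2⟩| ≤
            c₁ * Real.exp (-(δ₁ * (dist p.1.1 q.1.1
              + Metric.infDist p.1.1 (Ω \ Λ) + Metric.infDist q.1.1 (Ω \ Λ)))))) ∧
      -- (5.10), for `Ω ≠ ℤ^d`
      (Ωᶜ.Nonempty → ∀ (B : K d N → K d N → ℝ) (hAB : Hyp56L2 Ω (A + B) γ₀ c₀ δ₀), Hyp59Z Ω B c₀ δ₀ →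
        ∀ (Λ : Set (Fin d → ℤ)) (hΛ : Λ ⊆ Ω) (p q : idx N Λ),
          |Ginv hA hγ hc hδ hΛ p q - Ginv hAB hγ hc hδ hΛ p q| ≤
            c₁ * Real.exp (-(δ₁ * (dist p.1.1 q.1.1 + Metric.infDist p.1.1 Ωᶜ + Metric.infDist q.1.1 Ωᶜ))))

/-- **The Sect. 5 Theorem of B4 in `l²`-operator form holds**, with the explicit constants `(cStar, deltaStar)` of
`…B4Sect5Proof`. [cite: Balaban1983RegularityDecay, Sect. 5 Theorem p.594] -/
theorem sect5ThmL2_holds (d N : ℕ) : Sect5ThmL2 d N := by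
  intro γ₀ c₀ δ₀ hγ hc hδ
  refine ⟨cStar d N γ₀ c₀ δ₀, deltaStar d N γ₀ c₀ δ₀, cStar_pos d N c₀ δ₀ hγ, deltaStar_pos d N hγ hc.le hδ,
    fun Ω A hA => ⟨fun Λ hΛ => ⟨?_, ?_, ?_, ?_, ?_, ?_, ?_, ?_, ?_, ?_⟩, ?_⟩⟩
  · exact fun f i => opA_apply _ hc.le hδ f i
  · exact norm_opA_le _ hc.le hδ
  · exact fun f g => opA_symmetric _ hc.le hδ (hA.mono hc.le hδ hΛ).symm f g
  · exact fun f => inner_opA_self_ge ((hA.toZ hc.le hδ).mono hΛ) hc.le hδ f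
  · exact fun f => opAEquiv_apply _ hγ hc.le hδ f
  · exact norm_inv_le _ hγ hc.le hδ
  · exact fun w p => inv_apply_eq_tsum _ hγ hc.le hδ w p
  · exact fun p q => G_eq_limInv _ hγ hc hδ p q
  · exact fun p q => abs_G_le_exp _ hγ hc hδ p q
  · exact fun p q => G_sub_G_abs_le (hA.toZ hc.le hδ) hγ hc hδ hΛ p q
  · exact fun hΩc B hAB hB Λ hΛ p q => G_perturb_abs_le (hA.toZ hc.le hδ) (hAB.toZ hc.le hδ) hB hγ hc hδ hΩc hΛ p q

/-- The `l²` reading and the kernel reading of the theorem are the same theorem: (5.6) on `l²(Ω)` ⟺ (5.6) in kernel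
form, and the inverse-operator kernels ARE the exhaustion limits — so every conclusion of
`B4Sect5Exhaustion.sect5ThmSetOmega_holds` is a statement about the kernels of the operators `(A_Λ)⁻¹`. [folklore] -/
theorem sect5ThmSetOmega_of_L2 (hA : Hyp56L2 Ω A γ₀ c₀ δ₀) (hγ : 0 < γ₀) (hc : 0 < c₀) (hδ : 0 < δ₀)
    {Λ : Set (Fin d → ℤ)} (hΛ : Λ ⊆ Ω) (p q : idx N Λ) :
    Hyp56Z Ω A γ₀ c₀ δ₀ ∧ Ginv hA hγ hc hδ hΛ p q = limInv Λ A p.1 q.1 :=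
  ⟨hA.toZ hc.le hδ, G_eq_limInv _ hγ hc hδ p q⟩

/-- Non-vacuity on an infinite `Ω`: the identity operator on `l²(ℤ^d; ℝ^N)` satisfies (5.6) on `l²` with
`γ₀ = c₀ = δ₀ = 1`. [folklore] -/
theorem hyp56L2_one (d N : ℕ) :
    Hyp56L2 (Set.univ : Set (Fin d → ℤ)) (fun p q : K d N => if p = q then (1 : ℝ) else 0) 1 1 1 :=
  Hyp56L2.ofZ (hyp56Z_one d N) zero_le_one one_pos

end Headline

end

end Literature.MathematicalPhysics.QuantumFieldTheory.Balaban1983to89.B4Sect5L2
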